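import Literature.Probability.LatticeModels.BackboneChainRule
import Literature.Probability.LatticeModels.SharpLengthDCP
import Summits.CriticalPhenomena.Ising3DConformalLimit.Theses.CoerciveSharpness
import HarnessLib

/-!
# Sketch — crux idea `exit-entropy` for PhiCoercive (stmt-CriticalPhenomena-18196)

First checkable statements of the line "conserved first-exit backbone law + entropy
decomposition of log φ". Everything is over the tree's random-current exploration API
(`CurrentExploration`, `CurrentExplorationWeights`, `BackboneChainRule`): finite graph `G`,
couplings `K ≥ 0`, injective ranking `rk`, Aizenman's walk `Current.explore rk n Y a`, its final
states `Current.finalStates rk Y a u`, cylinder pattern weight `patSum K δ`, switched-off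
couplings `koff K D`, current sums `ecurrentSum K A = Z_K[A]`.
-/

noncomputable section

open Finset
open scoped symmDiff ENNReal BigOperators

namespace Summit.CriticalPhenomena.Ising3DConformalLimit.Cruxes.PhiCoercive.ExitEntropy

open Literature.Probability.LatticeModels

/-- **First lemma (L1, conservation of the first-exit law — exact).**  For a finite graph with
couplings `K ≥ 0`, an inner vertex set `S ∋ a` and an outer vertex `z ∉ S`, run Aizenman's walk of a
current with sources `{a} Δ {z}` from `a` with target `Sᶜ`: it stops at its FIRST EXIT from `S`, at
some `y ∉ S`.  Partitioning by the final state and factorising each cylinder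
(`Current.tsum_inCyl_of_mem_finalStates`) gives the identity
`Z_K[{a}Δ{z}] = Σ_{y ∉ S} Σ_{δ : first-exit states ending at y} patSum_K(δ) · Z_{K off used(δ)}[{y}Δ{z}]`
— the equality case of the chain rule `Current.tsum_backbonePass_mem_mul_le` BEFORE Griffiths'
comparison is applied.  Dividing by `Z_K[{a}Δ{z}]` this says: the cylinder weights
`P_z(δ) := patSum_K(δ) Z_{K off used(δ)}[{y}Δ{z}] / Z_K[{a}Δ{z}]` form a PROBABILITY measure on
first-exit states (the Ising analogue of "the exit distribution of a walk has mass one"). -/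
def FirstExitConservation : Prop :=
  ∀ {V : Type} [Fintype V] [DecidableEq V] (G : SimpleGraph V) [DecidableRel G.Adj]
    (K : G.edgeFinset → ℝ), (∀ e, 0 ≤ K e) →
    ∀ (rk : G.edgeFinset → ℕ), Function.Injective rk →
    ∀ (S : Finset V) (a z : V), a ∈ S → z ∉ S →
      ecurrentSum K ({a} ∆ {z}) =
        ∑ y ∈ Sᶜ, ∑ δ ∈ Current.finalStates rk Sᶜ a y,
          patSum K δ * ecurrentSum (koff K δ.used) ({y} ∆ {z})

/-- The couplings of the FREE system on `S`: `K` switched off on every bond meeting `Sᶜ`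
(so `Z_{K_S}[{a}Δ{x}]/Z_{K_S}[∅] = ⟨σ_aσ_x⟩^free_S` for `a, x ∈ S`). -/
def freeOn {V : Type} [Fintype V] [DecidableEq V] {G : SimpleGraph V} [DecidableRel G.Adj]
    (K : G.edgeFinset → ℝ) (S : Finset V) : G.edgeFinset → ℝ :=
  koff K (univ.filter fun e : G.edgeFinset => ∃ v ∈ Sᶜ, v ∈ (e : Sym2 V))

/-- **Second statement (L2, domination of first-exit cylinders by the free two-point function of
`S`).**  The total `K`-weight of the first-exit cylinders leaving `S` at `y`, with the interaction
switched off on their explored bonds, is at most `(Δ(G)+1) · sup_e tanh K_e · Σ_{x ∈ S, x ∼ y}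
⟨σ_aσ_x⟩^free_S · Z_K[∅]` — i.e. `Σ_{δ exits at y} ρ_Λ(δ) ≤ (Δ+1) t Σ_{x∼y} ⟨σ_aσ_x⟩^free_S`.
Ingredients: the star bound at the exit vertex (`Z_{off U}[∅] ≥ ∏ cosh · Z_{off U ∪ E_x}[∅]`),
Aizenman's super-multiplicativity `Current.ecurrentSum_koff_union_mul_ge` (Lemma 9.3) for the pair
(explored bonds inside `S`, bonds meeting `Sᶜ`), and the multiplicity `≤ Δ(G)+1` of arrival states
at `x` along one trail.  Summed over `y` and combined with L1 it re-proves the Simon–Lieb /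
Duminil-Copin–Tassion bound `φ_β(S) ≥ β/tanh β` up to the factor `Δ+1`; NOT summed, it is the
pointwise inequality `E ≥ 1` that makes every term of the entropy decomposition nonnegative. -/
def FirstExitDomination : Prop :=
  ∀ {V : Type} [Fintype V] [DecidableEq V] (G : SimpleGraph V) [DecidableRel G.Adj]
    (K : G.edgeFinset → ℝ), (∀ e, 0 ≤ K e) →
    ∀ (rk : G.edgeFinset → ℕ), Function.Injective rk →
    ∀ (S : Finset V) (a y : V), a ∈ S → y ∉ S →
      (∑ δ ∈ Current.finalStates rk Sᶜ a y,
          patSum K δ * ecurrentSum (koff K δ.used) ∅) * ecurrentSum (freeOn K S) ∅ ≤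
        (G.maxDegree + 1 : ℝ≥0∞) * (⨆ e : G.edgeFinset, ENNReal.ofReal (Real.tanh (K e))) *
          (∑ x ∈ S.filter (fun x => G.Adj x y), ecurrentSum (freeOn K S) ({a} ∆ {x})) *
            ecurrentSum K ∅

/-- **The transfer target, lattice form (C⁺, informal in the exponent; here its consequence that the
line must reach).**  On `ℤ³` with `K ≡ β < β_c` on the bonds of a large box `Λ_R ⊇ S ⊇ Λ_m`, L1–L2
and Jensen give `log[(Δ+1)(tanh β/β) φ_β(S)] ≥ E_P[log E] = E_P[ΔF] + E_P[log 1/c̄]`, and exactly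
`log M = E_P[ΔF] + E_P[log 1/c̄] + KL(P‖Q_S)` with `(tanh β/β)φ_β(S) ≤ M ≤ (Δ+1)(tanh β/β)φ_β(S)`.
Hence PhiCoercive follows from: SOME one of the three nonnegative terms is `≥ κ log m − C`
uniformly in finite `S ⊇ Λ_m` as `β ↑ β_c`.  Recorded here only as the crux it must imply
(`Iff.rfl` with the route decl, written with the tree's `dcpPhi`). -/
def Target : Prop :=
  ∃ κ c : ℝ, 0 < κ ∧ 0 < c ∧ ∀ m : ℕ, 1 ≤ m → ∀ S : Finset (Site 3), box 3 m ⊆ S →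
    c * (m : ℝ) ^ κ ≤ dcpPhi 3 (criticalBeta 3) S

/-- The recorded target IS the crux (definitional unfolding of `dcpPhi`). -/
example : Target ↔ Summit.CriticalPhenomena.Ising3DConformalLimit.Theses.CoerciveSharpness.PhiCoercive :=
  Iff.rfl

end Summit.CriticalPhenomena.Ising3DConformalLimit.Cruxes.PhiCoercive.ExitEntropy
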